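import Mathlib
import Summits.NavierStokesRegularity.NavierStokesRegularity.Theorems.ThreadingFluxHorizonTowerFiniteTowerToolkit
import Summits.NavierStokesRegularity.NavierStokesRegularity.Theorems.ThreadingFluxHorizonTowerNullConeZonalAxis
import Summits.NavierStokesRegularity.NavierStokesRegularity.Theorems.ThreadingFluxLoopLawSameDegreeBracketRigidity
import HarnessLib

/-!
# Crux `PoloidalLiouville` (stmt-NavierStokesRegularity-1222), crux idea «horizon-threading-tower» (ns-idea-15):
# FINITE TOWERS AT ORDER ONE — THE ISOLATION LEMMA (an isolated pair of shells satisfies the weighted Wronskian law)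

Support file (`--supports stmt-NavierStokesRegularity-1222`, helper; cell `ns-wall-extremal`, width hand ns-wall-eng-3 g4; 0 kit).

For a finite scale-free tower `Σ_{l ∈ K} U_{H_l}` of horizon profiles (smooth homogeneous harmonic shells `H_l`, `l ≥ 1`) annihilated by
the order-one horizon law `𝔏₁` off the centre, `finiteTower_parity_split` (p695631) gives, in each parity class of `j + k`, the
identity `Σ (λ_j − λ_k) ‖x‖^{−j−k} ⟪x, ∇H_j × ∇H_k⟫ = 0`.  This file turns it into POLYNOMIAL information on the null cone:

* `finiteTower_exists_polys` — polynomial models `P_l` (homogeneous of degree `l`, `lapP P_l = 0`) of the shells;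
* ★ `finiteTower_chartT_detP_eq_zero` — THE ISOLATION LEMMA: if `j₀ ≠ k₀` are degrees of the tower such that every OTHER pair
  `{j, k}` with `j + k ≥ j₀ + k₀` has vanishing bracket polynomial `detP P_j P_k = 0`, then the bracket of the pair `(j₀, k₀)` dies on
  the null cone: `chartT (detP P_{j₀} P_{k₀}) = 0` — equivalently (weighted Wronskian law `Zonal.chartT_detP`) the charts
  `f = chartT P_{j₀}`, `g = chartT P_{k₀}` satisfy `j₀ · f · g′ = k₀ · g · f′`.
  (Homogenise the class identity by `‖x‖^{j₀+k₀}`; the pairs above `j₀ + k₀` vanish, the pairs below carry a factor `r²` and die on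
  the cone (`Zonal.chartT_normSq_pow_mul`), the pair itself survives with the non-zero weight `2(λ_{j₀} − λ_{k₀})`.)
* `finiteTower_top_wronskian` — the top two degrees of any tower are isolated.

HONEST LABEL: algebra about one crux idea's typed objects; no sketch Prop closed; `HorizonTowerZonality` (general towers),
`PoloidalLiouville` (1222) OPEN; NS regularity NOT proved.  [folklore]
-/

-- the summit and its single sub-problem share the name (CONVENTIONS §1)
set_option linter.dupNamespace false

noncomputable section

open MvPolynomial Complex
open scoped Polynomial RealInnerProductSpace
open Literature.Analysis.FluidPDE (cross)
open Literature.Geometry.DiscreteGeometry (inner_fin3 norm_sq_fin3)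

namespace Summit.NavierStokesRegularity.NavierStokesRegularity.Theorems.PoloidalLiouville.HorizonTower

section FiniteTower

variable (K : Finset ℕ) (H : ℕ → E3 → ℝ)

/-- **Polynomial models of the shells**: every shell of the tower is (the function of) a homogeneous polynomial of its degree with
flat Laplacian zero. [folklore] -/
theorem finiteTower_exists_polys (hH : ∀ l ∈ K, ContDiff ℝ (⊤ : ℕ∞) (H l))
    (hhom : ∀ l ∈ K, ∀ (c : ℝ) (y : E3), H l (c • y) = c ^ l * H l y)
    (hharm : ∀ l ∈ K, ∀ y, Laplacian.laplacian (H l) y = 0) :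
    ∃ P : ℕ → MvPolynomial (Fin 3) ℝ, ∀ l ∈ K,
      (P l).IsHomogeneous l ∧ Zonal.lapP (P l) = 0 ∧ ∀ y, H l y = Zonal.evalE (P l) y := by
  classical
  have hex : ∀ l, ∃ p : MvPolynomial (Fin 3) ℝ, l ∈ K → p.IsHomogeneous l ∧ ∀ y, H l y = Zonal.evalE p y := by
    intro l
    by_cases hl : l ∈ K
    · obtain ⟨p, hp, hpy⟩ := Zonal.exists_mvPolynomial_of_homogeneous (hH l hl) (hhom l hl)
      exact ⟨p, fun _ => ⟨hp, hpy⟩⟩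
    · exact ⟨0, fun h => absurd h hl⟩
  choose P hP using hex
  refine ⟨P, fun l hl => ⟨(hP l hl).1, ?_, (hP l hl).2⟩⟩
  apply Zonal.eq_zero_of_evalE_eq_zero
  intro y
  have hfun : H l = Zonal.evalE (P l) := funext (hP l hl).2
  rw [← Zonal.laplacian_evalE, ← hfun]
  exact hharm l hl y

/-- The triple product of a polynomial with itself vanishes. [folklore] -/
theorem Zonal.detP_self' {R : Type*} [CommRing R] (a : MvPolynomial (Fin 3) R) : Zonal.detP a a = 0 := by
  unfold Zonal.detP; ring

/-- The triple product is antisymmetric. [folklore] -/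
theorem Zonal.detP_antisymm {R : Type*} [CommRing R] (a b : MvPolynomial (Fin 3) R) : Zonal.detP b a = -Zonal.detP a b := by
  unfold Zonal.detP; ring

/-- Evaluation of a power of `r² = x₀² + x₁² + x₂²`. [folklore] -/
theorem Zonal.evalE_normSq_pow (m : ℕ) (x : E3) :
    Zonal.evalE ((X 0 ^ 2 + X 1 ^ 2 + X 2 ^ 2) ^ m) x = (‖x‖ ^ 2) ^ m := by
  rw [norm_sq_fin3]
  simp [Zonal.evalE]

/-- The homogenising weight: `(‖x‖²)^{N/2} · (‖x‖²)^{−j/2} · (‖x‖²)^{−k/2} = (‖x‖²)^m` when `N = j + k + 2m`. [folklore] -/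
theorem rpow_weight_eq_pow {x : E3} (hx : x ≠ 0) {N j k m : ℕ} (h : N = j + k + 2 * m) :
    (‖x‖ ^ 2) ^ ((N : ℝ) / 2) * ((‖x‖ ^ 2) ^ (-(j : ℝ) / 2) * (‖x‖ ^ 2) ^ (-(k : ℝ) / 2)) = (‖x‖ ^ 2) ^ m := by
  have hr : 0 < ‖x‖ ^ 2 := by positivity
  have hN : (N : ℝ) = j + k + 2 * m := by exact_mod_cast h
  rw [← Real.rpow_add hr, ← Real.rpow_add hr,
    show ((N : ℝ) / 2 + (-(j : ℝ) / 2 + -(k : ℝ) / 2)) = (m : ℕ) by rw [hN]; ring, Real.rpow_natCast]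

/-- ★ **THE ISOLATION LEMMA.**  In a finite tower passing order one, let `j₀ ≠ k₀` be two degrees of `K` such that every other pair
`{j, k} ⊂ K` (`j ≠ k`) with `j + k ≥ j₀ + k₀` has `detP P_j P_k = 0`.  Then the bracket of the pair dies on the null cone:
`chartT (detP P_{j₀} P_{k₀}) = 0`. [folklore] -/
theorem finiteTower_chartT_detP_eq_zero (hK : ∀ l ∈ K, 1 ≤ l) (hH : ∀ l ∈ K, ContDiff ℝ (⊤ : ℕ∞) (H l))
    (hhom : ∀ l ∈ K, ∀ (c : ℝ) (y : E3), H l (c • y) = c ^ l * H l y)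
    (hharm : ∀ l ∈ K, ∀ y, Laplacian.laplacian (H l) y = 0)
    (hL1 : ∀ x : E3, x ≠ 0 → horizonL1 (fun z => ∑ l ∈ K, horizonProfile l (H l) 0 z) 0 x = 0)
    (P : ℕ → MvPolynomial (Fin 3) ℝ) (hP : ∀ l ∈ K, ∀ y, H l y = Zonal.evalE (P l) y)
    {j₀ k₀ : ℕ} (hj₀ : j₀ ∈ K) (hk₀ : k₀ ∈ K) (hjk : j₀ ≠ k₀)
    (hiso : ∀ j ∈ K, ∀ k ∈ K, j ≠ k → j₀ + k₀ ≤ j + k → ¬(j = j₀ ∧ k = k₀) → ¬(j = k₀ ∧ k = j₀) →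
      Zonal.detP (P j) (P k) = 0) :
    Zonal.chartT (map (algebraMap ℝ ℂ) (Zonal.detP (P j₀) (P k₀))) = 0 := by
  classical
  set N : ℕ := j₀ + k₀ with hN
  set ρ : MvPolynomial (Fin 3) ℝ := X 0 ^ 2 + X 1 ^ 2 + X 2 ^ 2 with hρ
  -- the bracket functions are the bracket polynomials
  have hB : ∀ j ∈ K, ∀ k ∈ K, ∀ x : E3,
      ⟪x, cross (gradient (H j) x) (gradient (H k) x)⟫ = Zonal.evalE (Zonal.detP (P j) (P k)) x := by
    intro j hj k hk x
    rw [show H j = Zonal.evalE (P j) from funext (hP j hj), show H k = Zonal.evalE (P k) from funext (hP k hk)]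
    exact LoopLaw.loopBracket_evalE (P j) (P k) x
  -- pairs strictly above `N` have vanishing bracket
  have habove : ∀ j ∈ K, ∀ k ∈ K, N < j + k → Zonal.detP (P j) (P k) = 0 := by
    intro j hj k hk hlt
    by_cases hjk' : j = k
    · rw [hjk', Zonal.detP_self']
    · exact hiso j hj k hk hjk' hlt.le (by rintro ⟨rfl, rfl⟩; omega) (by rintro ⟨rfl, rfl⟩; omega)
  -- the homogenised class polynomial
  set Q : MvPolynomial (Fin 3) ℝ := ∑ j ∈ K, ∑ k ∈ K,
    if j + k ≤ N ∧ (j + k) % 2 = N % 2 then C ((j : ℝ) * (j + 1) - (k : ℝ) * (k + 1)) * (ρ ^ ((N - (j + k)) / 2) * Zonal.detP (P j) (P k)) else 0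
    with hQ
  -- (1) it vanishes off the centre
  have hQx : ∀ x : E3, x ≠ 0 → Zonal.evalE Q x = 0 := by
    intro x hx
    obtain ⟨hE, hO⟩ := finiteTower_parity_split K H hK hH hhom hharm hL1 hx
    -- the class sum of the parity of `N`
    have hS : ∑ j ∈ K, ∑ k ∈ K, (if (j + k) % 2 = N % 2 then
        (((j : ℝ) * (j + 1) - (k : ℝ) * (k + 1)) * (‖x‖ ^ 2) ^ (-(j : ℝ) / 2) * (‖x‖ ^ 2) ^ (-(k : ℝ) / 2)
          * ⟪x, cross (gradient (H j) x) (gradient (H k) x)⟫) else 0) = 0 := by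
      rcases Nat.even_or_odd N with hNe | hNo
      · have hN0 : N % 2 = 0 := Nat.even_iff.mp hNe
        refine Eq.trans (Finset.sum_congr rfl fun j _ => Finset.sum_congr rfl fun k _ => ?_) hE
        rw [hN0]
        by_cases hjk2 : Even (j + k)
        · rw [if_pos (Nat.even_iff.mp hjk2), if_pos hjk2]
        · rw [if_neg (by rw [Nat.even_iff] at hjk2; exact hjk2), if_neg hjk2]
      · have hN1 : N % 2 = 1 := Nat.odd_iff.mp hNo
        refine Eq.trans (Finset.sum_congr rfl fun j _ => Finset.sum_congr rfl fun k _ => ?_) hO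
        rw [hN1]
        by_cases hjk2 : Even (j + k)
        · rw [if_neg (by rw [Nat.even_iff.mp hjk2]; decide), if_pos hjk2]
        · rw [if_pos (Nat.odd_iff.mp (Nat.not_even_iff_odd.mp hjk2)), if_neg hjk2]
    -- `evalE Q x = (‖x‖²)^{N/2} · class sum`
    have hterm : ∀ j ∈ K, ∀ k ∈ K,
        Zonal.evalE (if j + k ≤ N ∧ (j + k) % 2 = N % 2 then
            C ((j : ℝ) * (j + 1) - (k : ℝ) * (k + 1)) * (ρ ^ ((N - (j + k)) / 2) * Zonal.detP (P j) (P k)) else 0) x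
          = (‖x‖ ^ 2) ^ ((N : ℝ) / 2) * (if (j + k) % 2 = N % 2 then
            (((j : ℝ) * (j + 1) - (k : ℝ) * (k + 1)) * (‖x‖ ^ 2) ^ (-(j : ℝ) / 2) * (‖x‖ ^ 2) ^ (-(k : ℝ) / 2)
              * ⟪x, cross (gradient (H j) x) (gradient (H k) x)⟫) else 0) := by
      intro j hj k hk
      by_cases hpar : (j + k) % 2 = N % 2
      · by_cases hle : j + k ≤ N
        · -- a surviving pair: `N − (j + k) = 2m`
          obtain ⟨m, hm⟩ : ∃ m, N = j + k + 2 * m := ⟨(N - (j + k)) / 2, by omega⟩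
          have hm' : (N - (j + k)) / 2 = m := by omega
          rw [if_pos ⟨hle, hpar⟩, if_pos hpar, hm', hB j hj k hk x]
          have hw := rpow_weight_eq_pow hx hm
          have hρx : (eval fun i => x i) ρ = ‖x‖ ^ 2 := by rw [hρ, norm_sq_fin3]; simp
          simp only [Zonal.evalE, map_mul, eval_C, map_pow]
          rw [hρx, ← hw]
          ring
        · -- a pair above `N`: its bracket vanishes
          rw [if_neg (fun h => hle h.1), if_pos hpar, hB j hj k hk x, habove j hj k hk (not_le.mp hle)]
          simp [Zonal.evalE]
      · rw [if_neg (fun h => hpar h.2), if_neg hpar]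
        simp [Zonal.evalE]
    have hQe : Zonal.evalE Q x = (‖x‖ ^ 2) ^ ((N : ℝ) / 2) * ∑ j ∈ K, ∑ k ∈ K, (if (j + k) % 2 = N % 2 then
        (((j : ℝ) * (j + 1) - (k : ℝ) * (k + 1)) * (‖x‖ ^ 2) ^ (-(j : ℝ) / 2) * (‖x‖ ^ 2) ^ (-(k : ℝ) / 2)
          * ⟪x, cross (gradient (H j) x) (gradient (H k) x)⟫) else 0) := by
      rw [hQ, Finset.mul_sum]
      simp only [Zonal.evalE, map_sum]
      refine Finset.sum_congr rfl fun j hj => ?_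
      rw [Finset.mul_sum]
      refine Finset.sum_congr rfl fun k hk => ?_
      have := hterm j hj k hk
      simp only [Zonal.evalE] at this
      exact this
    rw [hQe, hS, mul_zero]
  -- (2) hence `Q = 0` (a polynomial function vanishing off the origin vanishes)
  have hQ0 : Q = 0 := by
    apply Zonal.eq_zero_of_evalE_eq_zero
    have hcont : Continuous (Zonal.evalE Q) := (Zonal.contDiff_evalE Q).continuous
    have hEq : Zonal.evalE Q = fun _ => (0 : ℝ) :=
      Continuous.ext_on (dense_compl_singleton (0 : E3)) hcont continuous_const fun x hx => hQx x hx
    intro y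
    rw [hEq]
  -- (3) complexify and go to the null cone: only the pair `(j₀, k₀)` survives
  have hchart := congrArg (fun q => Zonal.chartT (map (algebraMap ℝ ℂ) q)) hQ0
  simp only [map_zero, Zonal.chartT_zero] at hchart
  rw [hQ, map_sum, Zonal.chartT_sum] at hchart
  simp only [map_sum, Zonal.chartT_sum] at hchart
  rw [← Finset.sum_product' K K (fun j k => Zonal.chartT (map (algebraMap ℝ ℂ)
      (if j + k ≤ N ∧ (j + k) % 2 = N % 2 then C ((j : ℝ) * (j + 1) - (k : ℝ) * (k + 1)) * (ρ ^ ((N - (j + k)) / 2) * Zonal.detP (P j) (P k))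
        else 0)))] at hchart
  rw [Finset.sum_eq_add_of_mem (j₀, k₀) (k₀, j₀) (Finset.mk_mem_product hj₀ hk₀) (Finset.mk_mem_product hk₀ hj₀)
      (by simp [Prod.ext_iff, hjk]) ?_] at hchart
  · -- the two surviving terms
    have hself : (j₀ + k₀ ≤ N ∧ (j₀ + k₀) % 2 = N % 2) := ⟨le_rfl, rfl⟩
    have hself' : (k₀ + j₀ ≤ N ∧ (k₀ + j₀) % 2 = N % 2) := ⟨by omega, by rw [add_comm]⟩
    simp only [if_pos hself, if_pos hself', show (N - (j₀ + k₀)) / 2 = 0 by omega,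
      show (N - (k₀ + j₀)) / 2 = 0 by omega, pow_zero, one_mul, map_mul, map_C, Zonal.chartT_mul, Zonal.chartT_C,
      Zonal.detP_antisymm (P j₀) (P k₀), map_neg, Zonal.chartT_neg] at hchart
    have hne : (algebraMap ℝ ℂ) ((j₀ : ℝ) * (j₀ + 1)) - (algebraMap ℝ ℂ) ((k₀ : ℝ) * (k₀ + 1)) ≠ 0 := by
      rw [← map_sub, Ne, map_eq_zero_iff _ (algebraMap ℝ ℂ).injective]
      exact mul_succ_ne_of_ne hjk
    simp only [map_sub] at hchart
    have h2 : (Polynomial.C ((algebraMap ℝ ℂ) ((j₀ : ℝ) * (j₀ + 1))) - Polynomial.C ((algebraMap ℝ ℂ) ((k₀ : ℝ) * (k₀ + 1))))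
        * (2 * Zonal.chartT (map (algebraMap ℝ ℂ) (Zonal.detP (P j₀) (P k₀)))) = 0 := by
      linear_combination hchart
    rw [← Polynomial.C_sub] at h2
    rcases mul_eq_zero.mp h2 with h | h
    · exact absurd (Polynomial.C_eq_zero.mp h) hne
    · exact (mul_eq_zero.mp h).resolve_left two_ne_zero
  · -- every other pair contributes zero
    rintro ⟨j, k⟩ hjk' ⟨hne1, hne2⟩
    obtain ⟨hj, hk⟩ := Finset.mem_product.mp hjk'
    simp only at hj hk ⊢
    by_cases hcond : j + k ≤ N ∧ (j + k) % 2 = N % 2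
    · rw [if_pos hcond]
      rcases hcond.1.lt_or_eq with hlt | heq
      · -- below `N`: a genuine power of `r²`
        have hm : 1 ≤ (N - (j + k)) / 2 := by omega
        rw [map_mul, map_mul, map_pow, Zonal.chartT_mul, hρ]
        simp only [map_add, map_pow, map_X]
        rw [Zonal.chartT_normSq_pow_mul _ hm, mul_zero]
      · -- on the level `N`: the bracket itself vanishes
        have hD : Zonal.detP (P j) (P k) = 0 := by
          by_cases hjk2 : j = k
          · rw [hjk2, Zonal.detP_self']
          · exact hiso j hj k hk hjk2 heq.ge (fun h => hne1 (Prod.ext h.1 h.2)) (fun h => hne2 (Prod.ext h.1 h.2))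
        rw [hD, mul_zero, mul_zero, map_zero, Zonal.chartT_zero]
    · rw [if_neg hcond, map_zero, Zonal.chartT_zero]

/-- **The top pair of a tower is isolated**: with `D = max K` and `D′` the second largest degree, the charts `f = chartT P_{D′}`,
`g = chartT P_D` satisfy the weighted Wronskian law `D′ · f · g′ = D · g · f′`. [folklore] -/
theorem finiteTower_top_wronskian (hK : ∀ l ∈ K, 1 ≤ l) (hH : ∀ l ∈ K, ContDiff ℝ (⊤ : ℕ∞) (H l))
    (hhom : ∀ l ∈ K, ∀ (c : ℝ) (y : E3), H l (c • y) = c ^ l * H l y)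
    (hharm : ∀ l ∈ K, ∀ y, Laplacian.laplacian (H l) y = 0)
    (hL1 : ∀ x : E3, x ≠ 0 → horizonL1 (fun z => ∑ l ∈ K, horizonProfile l (H l) 0 z) 0 x = 0)
    (P : ℕ → MvPolynomial (Fin 3) ℝ) (hP : ∀ l ∈ K, (P l).IsHomogeneous l ∧ ∀ y, H l y = Zonal.evalE (P l) y)
    {D D' : ℕ} (hD : D ∈ K) (hD' : D' ∈ K) (hlt : D' < D) (hmax : ∀ l ∈ K, l ≤ D) (hsec : ∀ l ∈ K, l ≠ D → l ≤ D') :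
    (D' : ℂ[X]) * Zonal.chartT (map (algebraMap ℝ ℂ) (P D')) * Polynomial.derivative (Zonal.chartT (map (algebraMap ℝ ℂ) (P D)))
      = (D : ℂ[X]) * Zonal.chartT (map (algebraMap ℝ ℂ) (P D))
        * Polynomial.derivative (Zonal.chartT (map (algebraMap ℝ ℂ) (P D'))) := by
  have hiso := finiteTower_chartT_detP_eq_zero K H hK hH hhom hharm hL1 P (fun l hl => (hP l hl).2) hD' hD hlt.ne
    (by
      intro j hj k hk hjk hsum h1 h2
      exfalso
      have hjD := hmax j hj
      have hkD := hmax k hk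
      rcases eq_or_ne k D with rfl | hkne
      · have := hsec j hj hjk; omega
      · have hk' := hsec k hk hkne
        rcases eq_or_ne j D with rfl | hjne
        · omega
        · have hj' := hsec j hj hjne; omega)
  have hW := Zonal.chartT_detP ((hP D' hD').1.map (algebraMap ℝ ℂ)) ((hP D hD).1.map (algebraMap ℝ ℂ))
  rw [← Zonal.map_detP, hiso, mul_zero] at hW
  exact (sub_eq_zero.mp hW.symm)

end FiniteTower

end Summit.NavierStokesRegularity.NavierStokesRegularity.Theorems.PoloidalLiouville.HorizonTower

end
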